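import Summits.ResolutionOfSingularities.ResolutionOfSingularities.Theorems.FrobeniusLadderFInjectiveMacaulayficationFullLastCentreAxisOrder
import Summits.ResolutionOfSingularities.ResolutionOfSingularities.Theorems.FrobeniusLadderFInjectiveMacaulayficationFullLastCentreResidual
import HarnessLib

/-!
# K10d — THE FIRST POINT BLOW-UP IS NEVER WILD: from a stage without exceptional letters, at any chart origin of the point blow-up,
# the drop-point budget alone forces `ρ′ ≤ 8` (typed MC-8ᶜ for chains of length one; no canonicity, no toric budget needed)
# (crux `FInjectiveMacaulayfication` stmt-ResolutionOfSingularities-15315, chain w45a; kernel form of the depth-1 case of the point-chain cap K7 / `T-disc` R1, in the typed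
# `Stage` language of `Lines/T_canon_door.lean` v6.2; seat res-L1-w45a-lead-1 g16)

[OURS · L1 W4.5a] Support file (`--supports stmt-ResolutionOfSingularities-15315 --as helper`); replaces the role of NO printed item; NOT a statement of any manuscript;
proves nothing of the crux; OURS counted 0. AI-written (AI review is weaker than expert review).

THE STATEMENT (★★ `ordLE_eight_first_point_step`). Let `S₀` be a stage with NO exceptional letters (`S₀.Exc = ∅`, so its residual is `N₀ = Disc_x P₀` itself), `S₁` the
`y_L`-chart origin of the blow-up of the POINT (`IsChart S₀ univ L S₁`), `Disc_x P₁ = y^{α′}·N′` the residual decomposition at `x₁` (`IsResidual`), and assume the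
DROP-POINT BUDGET at `x₁`: some monomial of `Disc_x P₁` has degree `≤ 8 + 2·Σ_{E∋x₁} d_E` (`= 10`: the only exceptional letter is the new one, of defect `1`). Then
`ord₀ N′ ≤ 8`. MECHANISM (the two halves of the cap at depth one): with `ν := ord₀ N₀` (= `ord₀ Disc_x P₀`), (i) the EXPONENT IDENTITY `α′ = (ν − 6)·ε_L` (the new
divisor's level is `ν − 6`; from the support equation `y_L⁶·y^{α′}·N′ = σ_L(N₀)` and `N′` prime to `y_L`), so the budget monomial of `Disc_x P₁` yields a monomial of `N′`
of degree `≤ 10 − (ν − 6) = 16 − ν`; (ii) the POINT LAW `ρ′ ≤ ν` (K10 `rho_le_rho_of_point`). Hence `ρ′ ≤ min(ν, 16 − ν) ≤ 8`. Exponent bookkeeping only; no named fact.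
-/

-- single-problem summit: the doubled namespace component is forced
set_option linter.dupNamespace false

noncomputable section

open MvPolynomial Finsupp
open Summit.ResolutionOfSingularities.ResolutionOfSingularities.Theorems.FInjectiveMacaulayfication.LastCentreDefs
open Summit.ResolutionOfSingularities.ResolutionOfSingularities.Theorems.FInjectiveMacaulayfication.LastCentreAxisOrder

namespace Summit.ResolutionOfSingularities.ResolutionOfSingularities.Theorems.FInjectiveMacaulayfication.LastCentreFirstStep

variable {k : Type} [Field k]

/-- For the point centre, the `L`-exponent of `tau e` is the total degree of `e`. [plumbing] -/
theorem tau_univ_apply_self (L : Letter) (e : Expo) : tau Finset.univ L e L = tdeg e := by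
  rw [tau_apply_self Finset.univ L e (Finset.mem_univ L)]; rfl

/-- ★ THE NEW DIVISOR'S LEVEL AFTER A POINT BLOW-UP OF AN EXCEPTIONAL-FREE STAGE: if `Disc_x P₀ = N₀` (no exceptional letters), `Disc_x P₁ = y^{α′}·N′` at the
`y_L`-chart origin with `N′` prime to `y_L` and `α′` supported on `{L}`, and `ν = ord₀ N₀` (attained by `e₀`, a lower bound for all monomials), then
`α′ = (ν − 6)·ε_L` and `6 ≤ ν`. [OURS · L1 W4.5a] -/
theorem alpha_first_point_step {S₀ S₁ : Stage k} {L : Letter} {α' : Expo} {N' : YPoly k} (hExc : S₀.Exc = ∅)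
    (hch : IsChart S₀ Finset.univ L S₁) (hres : IsResidual S₁.Exc S₁.D α' N')
    {ν : ℕ} (e₀ : Expo) (he₀ : e₀ ∈ S₀.D.support) (hν₀ : tdeg e₀ = ν) (hν : ∀ e ∈ S₀.D.support, ν ≤ tdeg e) :
    α' = Finsupp.single L (ν - 6) ∧ 6 ≤ ν := by
  classical
  obtain ⟨hD', hα'off, hN'res⟩ := hres
  have hExc' : S₁.Exc = {L} := by rw [hch.2.2.2.1, hExc]; rfl
  -- support equation: σ_L(D₀) = y^{6ε_L + α′} · N′
  have hEQ : chartMap Finset.univ L S₀.D = monomial (Finsupp.single L 6 + α') (1 : k) * N' := by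
    rw [disc_chart hch, hD', ← mul_assoc, X_pow_eq_monomial, monomial_mul, one_mul]
  -- α′ is supported on {L}
  have hαL : ∀ n, n ≠ L → α' n = 0 := fun n hn => hα'off n (by rw [hExc']; simpa using hn)
  -- (≥): the monomial τe₀ of σ(D₀) lies in supp(y^B N′) ⇒ B ≤ τe₀ ⇒ 6 + α′_L ≤ (τe₀)_L = ν
  have h1 : 6 + α' L ≤ ν := by
    have hc : coeff (tau Finset.univ L e₀) (monomial (Finsupp.single L 6 + α') (1 : k) * N') ≠ 0 := by
      rw [← hEQ, coeff_tau_chartMap]; exact MvPolynomial.mem_support_iff.mp he₀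
    obtain ⟨hle, -⟩ := le_and_coeff_of_coeff_monomial_mul hc
    have := hle L
    simp only [Finsupp.coe_add, Pi.add_apply, Finsupp.single_eq_same, tau_univ_apply_self, hν₀] at this
    exact this
  -- (≤): N′ has a monomial e₁ with e₁_L = 0; B + e₁ ∈ supp σ(D₀) ⇒ = τe for some e ∈ supp D₀ ⇒ 6 + α′_L = (τe)_L = tdeg e ≥ ν
  have h2 : ν ≤ 6 + α' L := by
    obtain ⟨e₁, he₁, he₁L⟩ := hN'res L (by rw [hExc']; exact Finset.mem_singleton_self L)
    have hc : coeff (Finsupp.single L 6 + α' + e₁) (chartMap Finset.univ L S₀.D) ≠ 0 := by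
      rw [hEQ, coeff_add_monomial_mul]; exact MvPolynomial.mem_support_iff.mp he₁
    obtain ⟨e, he, heq⟩ := exists_of_mem_support_chartMap Finset.univ L S₀.D _ (MvPolynomial.mem_support_iff.mpr hc)
    have := congrArg (fun f => f L) heq
    simp only [Finsupp.coe_add, Pi.add_apply, Finsupp.single_eq_same, he₁L, add_zero, tau_univ_apply_self] at this
    have := hν e he
    omega
  refine ⟨?_, by omega⟩
  ext n
  by_cases hn : n = L
  · subst hn; rw [Finsupp.single_eq_same]; omega
  · rw [Finsupp.single_apply, if_neg (Ne.symm hn), hαL n hn]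

/-- ★★ THE FIRST POINT BLOW-UP IS NEVER WILD. From an exceptional-free stage, at any chart origin of the point blow-up carrying a residual decomposition and the
DROP-POINT BUDGET `ord₀ Disc_x P₁ ≤ 8 + 2·Σ_{E∋x₁} d_E` (= 10 here), the residual order is `ρ′ ≤ 8`. (`S₀.D ≠ 0` is implied by the residual witness at `x₁`.)
[OURS · L1 W4.5a] -/
theorem ordLE_eight_first_point_step {S₀ S₁ : Stage k} {L : Letter} {α' : Expo} {N' : YPoly k} (hExc : S₀.Exc = ∅)
    (hch : IsChart S₀ Finset.univ L S₁) (hres : IsResidual S₁.Exc S₁.D α' N')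
    (hbud : ∃ f ∈ S₁.D.support, (tdeg f : ℤ) ≤ 8 + 2 * ∑ n ∈ S₁.Exc, S₁.d n) : OrdLE N' 8 := by
  classical
  -- the residual decomposition of S₀ is (0, D₀)
  have hres₀ : IsResidual S₀.Exc S₀.D 0 S₀.D := by
    refine ⟨by rw [monomial_zero', C_1, one_mul], fun n _ => rfl, fun n hn => ?_⟩
    rw [hExc] at hn; exact absurd hn (Finset.notMem_empty n)
  -- D₀ ≠ 0 (from the residual witness at x₁ through the support equation)
  have hExc' : S₁.Exc = {L} := by rw [hch.2.2.2.1, hExc]; rfl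
  obtain ⟨e₁, he₁, -⟩ := hres.2.2 L (by rw [hExc']; exact Finset.mem_singleton_self L)
  have hD₀ : S₀.D.support.Nonempty := by
    rw [MvPolynomial.support_nonempty]; intro hz
    have hEQ : chartMap Finset.univ L S₀.D = monomial (Finsupp.single L 6 + α') (1 : k) * N' := by
      rw [disc_chart hch, hres.1, ← mul_assoc, X_pow_eq_monomial, monomial_mul, one_mul]
    rw [hz, map_zero] at hEQ
    have := congrArg (coeff (Finsupp.single L 6 + α' + e₁)) hEQ
    rw [coeff_zero, coeff_add_monomial_mul] at this
    exact (MvPolynomial.mem_support_iff.mp he₁) this.symm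
  -- ν = ord₀ D₀
  obtain ⟨e₀, he₀, hmin⟩ := Finset.exists_min_image S₀.D.support tdeg hD₀
  set ν := tdeg e₀ with hνdef
  obtain ⟨hα', h6⟩ := alpha_first_point_step hExc hch hres e₀ he₀ rfl hmin
  -- (ii) the point law: ρ′ ≤ ν
  have hlaw : OrdLE N' ν := rho_le_rho_of_point hch hres₀ hres ⟨e₀, he₀, le_rfl⟩
  -- (i) the budget monomial: f = α′ + e′ with e′ ∈ supp N′, tdeg e′ ≤ 10 − (ν − 6)
  obtain ⟨f, hf, hfb⟩ := hbud
  have hbound : (∑ n ∈ S₁.Exc, S₁.d n) = 1 := by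
    rw [hExc', Finset.sum_singleton, hch.2.2.2.2.2, hExc]
    simp
  rw [hbound] at hfb
  have hc : coeff f (monomial α' (1 : k) * N') ≠ 0 := by rw [← hres.1]; exact MvPolynomial.mem_support_iff.mp hf
  obtain ⟨hle, hc2⟩ := le_and_coeff_of_coeff_monomial_mul hc
  have hbud' : OrdLE N' (16 - ν) := by
    refine ⟨f - α', MvPolynomial.mem_support_iff.mpr hc2, ?_⟩
    rw [tdeg_tsub hle]
    have htα : tdeg α' = ν - 6 := by
      rw [hα', tdeg]
      rw [Finset.sum_eq_single L (fun n _ hn => by rw [Finsupp.single_apply, if_neg (Ne.symm hn)]) (by simp)]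
      rw [Finsupp.single_eq_same]
    have : (tdeg f : ℤ) ≤ 10 := by linarith
    omega
  -- conclude: min(ν, 16 − ν) ≤ 8
  by_cases hν8 : ν ≤ 8
  · obtain ⟨e, he, hd⟩ := hlaw; exact ⟨e, he, hd.trans hν8⟩
  · obtain ⟨e, he, hd⟩ := hbud'; exact ⟨e, he, by omega⟩

end Summit.ResolutionOfSingularities.ResolutionOfSingularities.Theorems.FInjectiveMacaulayfication.LastCentreFirstStep

end
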